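import Summits.QuantumFields.BalabanUV.T4Continuum.Support.DirichletVertexCover

/-!
# `BalabanUV.T4Continuum.Support.DirichletVertexDecaySum` — NE2 (node U1a) formalisation swarm, sub-row `T4-U1a.S-NE2-D1-DIRICHLET°`, supplier item
# «Δ1-SKELETON» (file 16): THE VERTEX-SUM DECAY — gen 6's local Morrey decay `morrey_decay_blockReg` at the lower corner of every block of an
# arbitrary family `A` of blocks carrying an exterior octant, SUMMED over the family with the `2^d` bounded overlap of file 15 and closed with the
# two global budgets of gan24-p2: `Σ_{β′ ∈ A} n²·dirOn univ (u ∘ chart (vtxBase m K β′)) ≤ θ_d^J·2^d·(γ′⁻¹ + 32(1+2^d)(1+(a′γ′⁻¹)²))·‖w‖²` for the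
# region Dirichlet solution `u = solExt n M a′ (blockReg S) w` — uniformly in the volume `M` and in the family `A`
# (unit b2b-balaban-t4-ne2-formalise-leaf-08, gen 7, file 16)

HONEST FRAMING.  Rung (B)+1 estimate at MODEL level (U = 1 scalar `Δ′ = Δ + a′Π′`, finite torus); [folklore]; NE2 (U1a) is NOT proved by this
file; spine PROVED 0/9 unchanged; NOT infinite volume, NOT the mass gap, NOT Clay.  HONEST DEPENDENCY (verbatim): «continuum YM on T⁴ ⇐
BetaPertH ∧ nine spine estimates (0/9 proved); BetaPertH ⇐ (D1) ∧ (D4) ∧ CAP+tail; G-an2-4 gates asym, D1 and NE2/3/4.»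

WHAT THIS FILE PROVES (0 sorry; gen 6's `morrey_decay_blockReg`, gan24-p2's `dirichlet_solExt_le` ∕ `sum_normSq_LapS_solExt_le`, file 15's
`sum_charts_le_two_pow_mul` BY NAME).  `vtxBase_eq_shift`, `dirOn_nonneg'`, `sum_normSq_dirOn_big_le` (`Σ_{β′} n²·dirOn(big cube) ≤ 2^d·dirichlet`),
`sum_restrict_big_le` (`Σ_{β′} Σ_j ‖1_ΩΔu‖² ≤ 2^d·Σ_Ω‖Δu‖²`), and the END **`sum_local_energy_decay_solExt`**.

ABSOLUTE RULE (cell, verbatim): «No internally-minted statement may enter as a cited fact. Every hypothesis is either kernel-proved in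
this package or a verbatim quotation of a PUBLISHED theorem with page reference. The manuscript(s) under audit are NOT citable for
their own disputed steps — they are the thing under adjudication; programme-internal (2001/route/tribunal) claims are never citable.»
[folklore]; no definition; no `def … : Prop` fact.  NOT CLAIMED: the cover of the cut-out by vertex neighbourhoods (d = 3, next file), NE2, NE3.
-/

noncomputable section

open scoped BigOperators ComplexConjugate Matrix
open Finset

namespace Summit.QuantumFields.BalabanUV.T4Continuum.DirichletVertexDecaySum

open Literature.MathematicalPhysics.QuantumFieldTheory.Balaban1983to89.B5Prop11Plancherel (Tor fine unitVec)
open Literature.MathematicalPhysics.QuantumFieldTheory.Balaban1983to89.B5Prop11Lower (nsq nsq_nonneg)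
open Literature.MathematicalPhysics.QuantumFieldTheory.Balaban1983to89.B5Action121 (sdiff LapS)
open Summit.QuantumFields.BalabanUV.Beta.GAN24.DirichletBoxTrace (blockReg)
open Summit.QuantumFields.BalabanUV.Beta.GAN24.DirichletBoxCompression (solExt solExt_apply_of_not dirichlet_solExt_le sum_normSq_LapS_solExt_le)
open Summit.QuantumFields.BalabanUV.T4Continuum.ScalarAveragedPropagator (gammaPs gammaPs_pos dirichlet)
open Summit.QuantumFields.BalabanUV.T4Continuum.DirichletDirectionalBesov (restrictTo nsqOn nsq_restrictTo)
open Summit.QuantumFields.BalabanUV.T4Continuum.CoordSlabPoincare (dirOn)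
open Summit.QuantumFields.BalabanUV.T4Continuum.DirichletHoleFillingCutoff (chart)
open Summit.QuantumFields.BalabanUV.T4Continuum.DirichletHoleFilling (theta theta_lt_one)
open Summit.QuantumFields.BalabanUV.T4Continuum.DirichletMorreyDecay (shift)
open Summit.QuantumFields.BalabanUV.T4Continuum.DirichletMorreyDecayBlock (cornerBase cornerBlock morrey_decay_blockReg)
open Summit.QuantumFields.BalabanUV.T4Continuum.DirichletMorreyDecaySolExt (normSq_mul_dirOn_eq)
open Summit.QuantumFields.BalabanUV.T4Continuum.DirichletVertexCubes (vtxBase)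
open Summit.QuantumFields.BalabanUV.T4Continuum.DirichletVertexCover (sum_charts_le_two_pow_mul)

variable {d : ℕ} (n : ℕ) [NeZero n] (M : Fin d → ℕ) [hM : ∀ μ, NeZero (M μ)]

omit [NeZero n] hM in
/-- the vertex cube at `K = 2^J m` is VERBATIM the small cube of gen 6's `morrey_decay_blockReg`. [folklore] -/
theorem vtxBase_eq_shift (m J : ℕ) (β' : Tor M) :
    vtxBase n M m (2 ^ J * m) β' = shift (fine n M) (2 * 2 ^ J * m - 2 * m) (cornerBase n M β' (2 ^ J * m)) := by
  rw [vtxBase, Nat.mul_assoc]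

/-- a Dirichlet form is non-negative. [folklore] -/
theorem dirOn_nonneg' {nn : ℕ} (s : Finset (Fin d → Fin (nn + 1))) (F : (Fin d → Fin (nn + 1)) → ℂ) : 0 ≤ dirOn s F := by
  unfold dirOn
  exact Finset.sum_nonneg fun _ _ => Finset.sum_nonneg fun _ _ => sq_nonneg _

section Big

variable {n M}

/-- **big-cube energies summed over all vertices**: `Σ_{β′} n²·dirOn univ (z ∘ chart (cornerBase β′ K)) ≤ 2^d·dirichlet z`. [folklore] -/
theorem sum_normSq_dirOn_big_le {K : ℕ} (hK : 2 * K ≤ n) {nn : ℕ} (hnn : 4 * K = nn + 1) (hN' : ∀ ν, nn + 1 ≤ fine n M ν)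
    (z : Tor (fine n M) → ℂ) :
    ∑ β' : Tor M, (n : ℝ) ^ 2 * dirOn (univ : Finset (Fin d → Fin (nn + 1))) (z ∘ chart (fine n M) (n := nn) (cornerBase n M β' K))
      ≤ 2 ^ d * dirichlet n M z := by
  have hstep : ∀ β' : Tor M,
      (n : ℝ) ^ 2 * dirOn (univ : Finset (Fin d → Fin (nn + 1))) (z ∘ chart (fine n M) (n := nn) (cornerBase n M β' K))
        ≤ ∑ ν : Fin d, ∑ j : Fin d → Fin (nn + 1), ‖(sdiff (fine n M) (n : ℂ) ν *ᵥ z) (chart (fine n M) (cornerBase n M β' K) j)‖ ^ 2 := by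
    intro β'
    rw [normSq_mul_dirOn_eq]
    exact Finset.sum_le_sum fun ν _ =>
      Finset.sum_le_sum_of_subset_of_nonneg (Finset.filter_subset _ _) fun _ _ _ => sq_nonneg _
  refine (Finset.sum_le_sum fun β' _ => hstep β').trans ?_
  rw [Finset.sum_comm, dirichlet, Finset.mul_sum]
  refine Finset.sum_le_sum fun ν _ => ?_
  have h := sum_charts_le_two_pow_mul hK hnn hN' (G := fun y => ‖(sdiff (fine n M) (n : ℂ) ν *ᵥ z) y‖ ^ 2) (fun _ => sq_nonneg _)
  rw [nsq]
  exact h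

/-- **big-cube source masses summed over all vertices**: `Σ_{β′} Σ_j ‖(1_Ω f)(chart (cornerBase β′ K) j)‖² ≤ 2^d·Σ_{Ω} ‖f‖²`. [folklore] -/
theorem sum_restrict_big_le {K : ℕ} (hK : 2 * K ≤ n) {nn : ℕ} (hnn : 4 * K = nn + 1) (hN' : ∀ ν, nn + 1 ≤ fine n M ν)
    (Ω : Tor (fine n M) → Prop) [DecidablePred Ω] (f : Tor (fine n M) → ℂ) :
    ∑ β' : Tor M, ∑ j : Fin d → Fin (nn + 1), ‖restrictTo Ω f (chart (fine n M) (cornerBase n M β' K) j)‖ ^ 2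
      ≤ 2 ^ d * ∑ a : {x // Ω x}, ‖f a‖ ^ 2 := by
  have h := sum_charts_le_two_pow_mul hK hnn hN' (G := fun y => ‖restrictTo Ω f y‖ ^ 2) (fun _ => sq_nonneg _)
  refine h.trans (le_of_eq ?_)
  have := nsq_restrictTo Ω f
  rw [nsq, nsqOn] at this
  rw [this]

end Big

/-! ## The END -/

section End

variable {n M}

/-- **THE VERTEX-SUM DECAY OF THE REGION DIRICHLET SOLUTION.**  `d ≥ 2`, `a′ > 0`, `S` a block set, `A` ANY finite family of blocks and `σ`
a choice of an exterior octant at the lower corner of each `β′ ∈ A` (`cornerBlock β′ (σ β′) ∉ S`); `m ≥ 1`, `4m = n₀ + 1`, `K = 2^J m`,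
`2K ≤ n`, `4K = nn + 1 ≤ n·M ν`.  For `u = solExt n M a′ (blockReg S) w`:
`Σ_{β′ ∈ A} n²·dirOn univ (u ∘ chart (vtxBase m K β′)) ≤ θ_d^J·(2^d·(γ′⁻¹ + 32(1+2^d)(1+(a′γ′⁻¹)²)))·‖w‖²`. [folklore] -/
theorem sum_local_energy_decay_solExt (hd : 2 ≤ d) {a' : ℝ} (ha' : 0 < a') (S : Tor M → Prop) [DecidablePred S] (A : Finset (Tor M))
    (σ : Tor M → Fin d → Bool) (hA : ∀ β' ∈ A, ¬ S (cornerBlock M β' (σ β'))) {m : ℕ} (hm : 1 ≤ m) {n₀ : ℕ} (hn₀ : 4 * m = n₀ + 1)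
    (J : ℕ) {nn : ℕ} (hnn : 4 * (2 ^ J * m) = nn + 1) (hK : 2 * (2 ^ J * m) ≤ n) (hN' : ∀ ν, nn + 1 ≤ fine n M ν)
    (w : {x // blockReg n M S x} → ℂ) :
    ∑ β' ∈ A, (n : ℝ) ^ 2 * dirOn (univ : Finset (Fin d → Fin (n₀ + 1)))
        (solExt n M a' (blockReg n M S) w ∘ chart (fine n M) (n := n₀) (vtxBase n M m (2 ^ J * m) β'))
      ≤ theta d ^ J * (2 ^ d * ((gammaPs d a')⁻¹ + 32 * (1 + 2 ^ d) * (1 + (a' * (gammaPs d a')⁻¹) ^ 2))) * nsq w := by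
  set u := solExt n M a' (blockReg n M S) w with hu
  set K := 2 ^ J * m with hKdef
  have hz : ∀ x, ¬ blockReg n M S x → u x = 0 := fun x hx => solExt_apply_of_not n M a' _ w hx
  have hnpos : (0 : ℝ) < n := by exact_mod_cast Nat.pos_of_ne_zero (NeZero.ne n)
  have hn0 : (n : ℝ) ≠ 0 := hnpos.ne'
  have hc : (n : ℂ) ≠ 0 := by exact_mod_cast (NeZero.ne n)
  have hθ : 0 ≤ theta d ^ J := pow_nonneg (by linarith [(theta_lt_one d).1]) J
  have hγ := (gammaPs_pos (d := d) (a' := a')).1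
  -- abbreviations for the big-cube data
  set P : Tor M → ℝ := fun β' => (n : ℝ) ^ 2 * dirOn (univ : Finset (Fin d → Fin (nn + 1))) (u ∘ chart (fine n M) (n := nn) (cornerBase n M β' K))
    with hP
  set Q : Tor M → ℝ := fun β' => ∑ j : Fin d → Fin (nn + 1),
      ‖restrictTo (blockReg n M S) (LapS (fine n M) (n : ℂ) *ᵥ u) (chart (fine n M) (cornerBase n M β' K) j)‖ ^ 2 with hQ
  set cK : ℝ := 64 * (1 + 2 ^ d) * (K : ℝ) ^ 2 / (n : ℝ) ^ 2 with hcK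
  have hcK0 : 0 ≤ cK := by rw [hcK]; positivity
  have hP0 : ∀ β', 0 ≤ P β' := fun β' => by rw [hP]; exact mul_nonneg (sq_nonneg _) (dirOn_nonneg' _ _)
  have hQ0 : ∀ β', 0 ≤ Q β' := fun β' => by rw [hQ]; exact Finset.sum_nonneg fun _ _ => sq_nonneg _
  -- per-vertex decay, in energy units
  have hloc : ∀ β' ∈ A, (n : ℝ) ^ 2 * dirOn (univ : Finset (Fin d → Fin (n₀ + 1)))
        (u ∘ chart (fine n M) (n := n₀) (vtxBase n M m (2 ^ J * m) β')) ≤ theta d ^ J * (P β' + cK * Q β') := by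
    intro β' hβ'
    have hdec := morrey_decay_blockReg n M hd hc S hz β' (σ β') (hA β' hβ') hm hn₀ J hnn hK hN'
    rw [vtxBase_eq_shift]
    have h2 := mul_le_mul_of_nonneg_left hdec (sq_nonneg (n : ℝ))
    refine h2.trans (le_of_eq ?_)
    rw [hP, hQ, hcK, Complex.norm_natCast]
    field_simp
    ring
  -- the two global budgets through the bounded overlap
  have h1 : ∑ β' : Tor M, P β' ≤ 2 ^ d * ((gammaPs d a')⁻¹ * nsq w) :=
    (sum_normSq_dirOn_big_le hK hnn hN' u).trans (mul_le_mul_of_nonneg_left (dirichlet_solExt_le n M a' _ ha' w) (by positivity))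
  have h2 : ∑ β' : Tor M, Q β' ≤ 2 ^ d * (2 * (1 + (a' * (gammaPs d a')⁻¹) ^ 2) * nsq w) :=
    (sum_restrict_big_le hK hnn hN' (blockReg n M S) (LapS (fine n M) (n : ℂ) *ᵥ u)).trans
      (mul_le_mul_of_nonneg_left (sum_normSq_LapS_solExt_le n M a' _ ha' w) (by positivity))
  have hcK16 : cK ≤ 16 * (1 + 2 ^ d) := by
    rw [hcK, div_le_iff₀ (by positivity)]
    have hKn : 2 * (K : ℝ) ≤ n := by exact_mod_cast hK
    have h4 : 4 * (K : ℝ) ^ 2 ≤ (n : ℝ) ^ 2 := by nlinarith [hKn, sq_nonneg (K : ℝ)]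
    calc 64 * (1 + 2 ^ d) * (K : ℝ) ^ 2 = 16 * (1 + 2 ^ d) * (4 * (K : ℝ) ^ 2) := by ring
      _ ≤ 16 * (1 + 2 ^ d) * (n : ℝ) ^ 2 := mul_le_mul_of_nonneg_left h4 (by positivity)
  -- assemble
  calc ∑ β' ∈ A, (n : ℝ) ^ 2 * dirOn (univ : Finset (Fin d → Fin (n₀ + 1))) (u ∘ chart (fine n M) (n := n₀) (vtxBase n M m (2 ^ J * m) β'))
      ≤ ∑ β' ∈ A, theta d ^ J * (P β' + cK * Q β') := Finset.sum_le_sum hloc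
    _ ≤ ∑ β' : Tor M, theta d ^ J * (P β' + cK * Q β') :=
        Finset.sum_le_sum_of_subset_of_nonneg (Finset.subset_univ _) fun β' _ _ =>
          mul_nonneg hθ (add_nonneg (hP0 β') (mul_nonneg hcK0 (hQ0 β')))
    _ = theta d ^ J * (∑ β' : Tor M, P β' + cK * ∑ β' : Tor M, Q β') := by
        rw [← Finset.mul_sum, Finset.sum_add_distrib, Finset.mul_sum]
    _ ≤ theta d ^ J * (2 ^ d * ((gammaPs d a')⁻¹ * nsq w) + 16 * (1 + 2 ^ d) * (2 ^ d * (2 * (1 + (a' * (gammaPs d a')⁻¹) ^ 2) * nsq w))) := by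
        refine mul_le_mul_of_nonneg_left ?_ hθ
        have : cK * ∑ β' : Tor M, Q β' ≤ 16 * (1 + 2 ^ d) * (2 ^ d * (2 * (1 + (a' * (gammaPs d a')⁻¹) ^ 2) * nsq w)) :=
          (mul_le_mul_of_nonneg_left h2 hcK0).trans
            (mul_le_mul_of_nonneg_right hcK16 (mul_nonneg (by positivity) (mul_nonneg (by positivity) (nsq_nonneg w))))
        linarith
    _ = theta d ^ J * (2 ^ d * ((gammaPs d a')⁻¹ + 32 * (1 + 2 ^ d) * (1 + (a' * (gammaPs d a')⁻¹) ^ 2))) * nsq w := by ring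

end End

end Summit.QuantumFields.BalabanUV.T4Continuum.DirichletVertexDecaySum

end
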